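import Summits.NavierStokesRegularity.NavierStokesRegularity.Theses.TypeILiouville
import Literature.Analysis.FluidPDE.AncientL3BackwardLiouville
import Literature.Analysis.FluidPDE.KNSSRegularityGalileanProofs
import Literature.Analysis.FluidPDE.OseenHeatKernelBridge
import Literature.Analysis.FluidPDE.KNSSWeakDriftMild
import Literature.Analysis.FluidPDE.KNSSOseenMildDecayTools
import Literature.Analysis.FluidPDE.NSBoundedMildSmoothing
import HarnessLib

/-!
# Stub `stub_oseen_const_boost` (crux `TypeIliouvilleL`, stmt-NavierStokesRegularity-10661,
# line `registered`): the constant Galilean boost of a bounded Oseen-mild ancient solution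

Helper file (lands `--supports stmt-NavierStokesRegularity-10661`; theorems only, no definitions,
no named facts). Let `v : (−∞,0) × ℝ³ → ℝ³` be a bounded ancient mild solution of Navier–Stokes
(`ν = 1`) in the integral-equation sense of Koch–Nadirashvili–Seregin–Šverák 2009, §4 (i) — the
four hypotheses of the tree fact
`Literature.Analysis.FluidPDE.AlbrittonBarker2019_liouville_L3_backward`: continuous on the open
backward slab, bounded there, weakly divergence-free slices, and
`v(t) = e^{(t−s)Δ}v(s) − B¹_s(v,v)(t)` pointwise for all `s < t < 0`. For a constant vector `c`
the **Galilean boost** `w(t, y) = v(t, y + t•c) − c` is again such a solution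
(`stub_oseen_const_boost`). Continuity, the bound `K + ‖c‖` and weak divergence-freeness
(translation invariance of Lebesgue measure, `IsWeaklyDivFree.comp_add_right'`, and subtraction of
a constant) are routine; the content is the Oseen identity for `w`, in which the moving frame
`t•c` mixes space and time (the transport term `(c·∇)v` has to be absorbed).

## Proof of the Oseen identity

Pure bookkeeping over the tree's proved Galilean covariance of KNSS's drift-mild class
(`IsKNSSDriftMild.galileanCovariance_R3`, `KNSSRegularityGalileanProofs.lean`). Fix `s < t < 0`,
put `a = s − 1`, `t' = t/2` and the window `(0, T)`, `T = t' − a`, in the clock `τ = σ − a`,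
clamped by `κ τ = min (τ + a) t'` (so `κ τ = τ + a` on `[0, T]` and `κ < 0` everywhere, which makes
the re-clocked field globally continuous, hence jointly measurable). With the spatially translated
field `v₁(σ, z) = v(σ, z + a•c)` (again Oseen-mild: `heatExtension_comp_add_right_apply`,
`oseenDuhamel_comp_add_right`), the pair `U τ z = v₁(κ τ, z) − c`, `b ≡ c` is drift-mild on
`(0, T)` with bound `K + ‖c‖` (`driftMild_window`): the drift-mild identity is the Oseen identity
of `v₁` once `e^{τΔ}(g − c) = e^{τΔ}g − c` (`heatExtension_sub_of_bound`, `heatExtension_const`)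
and `driftDuhamel U b = B¹(v₁(· + a), v₁(· + a))` (the tensor of `U + b = v₁` is that of the pair
`(v₁, 0)`; `driftDuhamel_zero_eq_oseenDuhamel`; `oseenDuhamel_translate`) are inserted. Galilean
covariance makes `galileanShift U b` drift-mild with ZERO drift, and since `driftPath b τ = τ•c`,
`galileanShift U b τ = w(τ + a)` for `τ + a ≤ t'` (`(τ + a)•c = τ•c + a•c`);
`IsKNSSDriftMild.eq_heatExtension_sub_oseenDuhamel` at the window times `s − a < t − a` is the
claim after translating the Duhamel term back in time (`oseenDuhamel_congr_ae_slice`,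
`oseenDuhamel_translate`).

## References

* G. Koch, N. Nadirashvili, G. Seregin, V. Šverák, *Liouville theorems for the Navier–Stokes
  equations and applications*, Acta Math. 203 (2009) 83–105 = arXiv:0709.3599, §1 p. 3 (parasitic
  solutions, Galilean frame), §4 (i), (4.3)–(4.4). [KochNadirashviliSereginSverak2009]
* A. J. Majda, A. L. Bertozzi, *Vorticity and Incompressible Flow* (CUP 2002), §1.2 (Galilean
  invariance). [MajdaBertozziCUP2002]
-/

-- the summit and its single problem share the name (D-0017 nested layout)
set_option linter.dupNamespace false

noncomputable section

namespace Summit.NavierStokesRegularity.NavierStokesRegularity.Theorems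

open MeasureTheory Filter Set Function
open Literature.Analysis Literature.Analysis.FluidPDE

namespace TypeIliouvilleL.ConstBoost

/-! ### The window pair is drift-mild -/

/-- **The re-clocked, constant-drift pair of an Oseen-mild ancient field is drift-mild on the
window.** Let `v` be continuous and bounded by `K ≥ 0` on the open backward slab, with weakly
divergence-free slices and the Oseen identity `v(t) = e^{(t−s)Δ}v(s) − B¹_s(v,v)(t)` for
`s < t < 0`; let `c` be a constant vector and `κ` a continuous clock with negative values and
`κ τ = τ + a` on `[0, T]`. Then `U τ z = v(κ τ, z) − c` with the constant drift `b ≡ c` is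
drift-mild on `(0, T)` with bound `K + ‖c‖` in the sense of KNSS (`IsKNSSDriftMild`): the tensor
of the full velocity `U + b = v(κ ·)` is that of the zero-drift pair `(v(κ ·), 0)`, so the Duhamel
term is `B¹_{σ+a}(v, v)(τ + a)` (`driftDuhamel_zero_eq_oseenDuhamel`, `oseenDuhamel_translate`),
and `e^{(τ−σ)Δ}(v(σ+a) − c) = e^{(τ−σ)Δ}v(σ+a) − c`. [cite: KochNadirashviliSereginSverak2009, §1 p. 3 and §4 (i), (4.3)–(4.4) (arXiv:0709.3599v1 pp. 3, 8)] -/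
theorem driftMild_window {v : ℝ → EuclideanSpace ℝ (Fin 3) → EuclideanSpace ℝ (Fin 3)} {K : ℝ}
    (hK0 : 0 ≤ K)
    (hcont : ContinuousOn (uncurry v) (Iio 0 ×ˢ univ))
    (hK : ∀ t < 0, ∀ x, ‖v t x‖ ≤ K)
    (hdiv : ∀ t < 0, IsWeaklyDivFree (v t))
    (hmild : ∀ s t : ℝ, s < t → t < 0 → ∀ x,
      v t x = UnboundedOperators.heatExtension (v s) (t - s) x - oseenDuhamel 1 s v v t x)
    (c : EuclideanSpace ℝ (Fin 3)) {a T : ℝ} {κ : ℝ → ℝ} (hκc : Continuous κ)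
    (hκ0 : ∀ τ, κ τ < 0)
    (hκw : ∀ τ ∈ Icc (0 : ℝ) T, κ τ = τ + a) :
    IsKNSSDriftMild T (K + ‖c‖) (fun τ z => v (κ τ) z - c) (fun _ => c) := by
  have hE : Module.finrank ℝ (EuclideanSpace ℝ (Fin 3)) = 3 := finrank_euclideanSpace_fin
  have hvc : ∀ σ : ℝ, σ < 0 → Continuous (v σ) := fun σ hσ =>
    hcont.comp_continuous (continuous_const.prodMk continuous_id) fun z =>
      mk_mem_prod (mem_Iio.2 hσ) (mem_univ z)
  have hUc : Continuous (uncurry fun τ z => v (κ τ) z - c) := by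
    have h1 : Continuous fun q : ℝ × EuclideanSpace ℝ (Fin 3) => uncurry v (κ q.1, q.2) :=
      hcont.comp_continuous ((hκc.comp continuous_fst).prodMk continuous_snd)
        fun q => mk_mem_prod (mem_Iio.2 (hκ0 q.1)) (mem_univ _)
    exact h1.sub continuous_const
  refine
    { measurable_drift := measurable_const
      norm_drift_le := fun _ => le_add_of_nonneg_left hK0
      measurable := hUc.measurable
      norm_le := fun τ _ z => ?_
      ae_isWeaklyDivFree := Eventually.of_forall fun τ => ?_
      mild := fun σ' τ' hσ' hσ'τ' hτ'T x => ?_ }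
  · -- the bound (everywhere)
    show ‖v (κ τ) z - c‖ ≤ K + ‖c‖
    exact (norm_sub_le _ _).trans (add_le_add (hK _ (hκ0 τ) z) le_rfl)
  · -- every slice is weakly divergence free
    show IsWeaklyDivFree fun z => v (κ τ) z - c
    exact (hdiv _ (hκ0 τ)).sub_of_locallyIntegrable (isWeaklyDivFree_const c)
      (hvc _ (hκ0 τ)).locallyIntegrable continuous_const.locallyIntegrable
  · -- the drift-mild identity on the window = the Oseen identity of `v`, re-clocked
    show v (κ τ') x - c =
      UnboundedOperators.heatExtension (fun z => v (κ σ') z - c) (τ' - σ') x -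
        driftDuhamel (fun τ z => v (κ τ) z - c) (fun _ => c) σ' τ' x
    have hκσ : κ σ' = σ' + a := hκw σ' ⟨hσ'.le, (hσ'τ'.trans hτ'T).le⟩
    have hκτ : κ τ' = τ' + a := hκw τ' ⟨(hσ'.trans hσ'τ').le, hτ'T.le⟩
    have hs0 : σ' + a < 0 := by rw [← hκσ]; exact hκ0 σ'
    have ht0 : τ' + a < 0 := by rw [← hκτ]; exact hκ0 τ'
    have hpos : 0 < τ' - σ' := sub_pos.2 hσ'τ'
    rw [hκτ, hκσ]
    -- the caloric term
    rw [UnboundedOperators.heatExtension_sub_of_bound (hvc _ hs0) continuous_const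
        (hK _ hs0) (fun _ => le_rfl) hpos x,
      UnboundedOperators.heatExtension_const _ hpos x]
    -- the Duhamel term
    have hDD : driftDuhamel (fun τ z => v (κ τ) z - c) (fun _ => c) σ' τ' x =
        oseenDuhamel 1 (σ' + a) v v (τ' + a) x := by
      have step1 : driftDuhamel (fun τ z => v (κ τ) z - c) (fun _ => c) σ' τ' x =
          driftDuhamel (fun τ => v (κ τ)) 0 σ' τ' x := by
        have hT : driftTensor (fun τ z => v (κ τ) z - c) (fun _ => c) =
            driftTensor (fun τ => v (κ τ)) 0 := by
          funext ρ j k y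
          simp only [driftTensor_apply, sub_add_cancel, Pi.zero_apply, add_zero]
        rw [driftDuhamel_apply, driftDuhamel_apply, hT]
      have step2 : driftDuhamel (fun τ => v (κ τ)) 0 σ' τ' x =
          oseenDuhamel 1 σ' (fun τ => v (κ τ)) (fun τ => v (κ τ)) τ' x :=
        driftDuhamel_zero_eq_oseenDuhamel hE (fun ρ _ => (hvc _ (hκ0 ρ)).measurable)
          (fun ρ _ y => hK _ (hκ0 ρ) y) hσ'τ'.le x
      have step3 : oseenDuhamel 1 σ' (fun τ => v (κ τ)) (fun τ => v (κ τ)) τ' x =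
          oseenDuhamel 1 σ' (fun τ => v (τ + a)) (fun τ => v (τ + a)) τ' x := by
        have hI : ∀ ρ ∈ Ioo σ' τ', v (κ ρ) =ᵐ[volume] v (ρ + a) := by
          intro ρ hρ
          rw [hκw ρ ⟨(hσ'.trans hρ.1).le, (hρ.2.trans hτ'T).le⟩]
        exact oseenDuhamel_congr_ae_slice hI hI x
      rw [step1, step2, step3, oseenDuhamel_translate]
    rw [hDD]
    have key := hmild (σ' + a) (τ' + a) (by linarith) ht0 x
    rw [show τ' + a - (σ' + a) = τ' - σ' by ring] at key
    rw [key]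
    abel

end TypeIliouvilleL.ConstBoost

open TypeIliouvilleL.ConstBoost in
/-- **Stub `stub_oseen_const_boost` of the line `registered` (crux `TypeIliouvilleL`): the
constant Galilean boost of a bounded Oseen-mild ancient solution is again one.** If
`v : ℝ → ℝ³ → ℝ³` is continuous on the open backward slab `(−∞,0) × ℝ³`, bounded there, has weakly
divergence-free slices and satisfies the Oseen integral identity
`v(t) = e^{(t−s)Δ}v(s) − B¹_s(v,v)(t)` pointwise for all `s < t < 0` (the hypotheses of
`Literature.Analysis.FluidPDE.AlbrittonBarker2019_liouville_L3_backward`), then so does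
`w(t, y) = v(t, y + t•c) − c` for every constant vector `c` (Galilean invariance of Navier–Stokes
with constant frame velocity; the special case `b ≡ c` of the tree's
`IsKNSSDriftMild.galileanCovariance_R3`, read through
`IsKNSSDriftMild.eq_heatExtension_sub_oseenDuhamel`; module docstring). [cite: KochNadirashviliSereginSverak2009, §1 p. 3 and §4 (i), (4.3)–(4.4) (arXiv:0709.3599v1 pp. 3, 8)] -/
theorem stub_oseen_const_boost :
    ∀ (v : ℝ → EuclideanSpace ℝ (Fin 3) → EuclideanSpace ℝ (Fin 3))
      (c : EuclideanSpace ℝ (Fin 3)),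
      ContinuousOn (uncurry v) (Iio 0 ×ˢ univ) →
      (∃ K : ℝ, ∀ t < 0, ∀ x, ‖v t x‖ ≤ K) →
      (∀ t < 0, Literature.Analysis.FluidPDE.IsWeaklyDivFree (v t)) →
      (∀ s t : ℝ, s < t → t < 0 → ∀ x,
        v t x = Literature.Analysis.UnboundedOperators.heatExtension (v s) (t - s) x -
          Literature.Analysis.FluidPDE.oseenDuhamel 1 s v v t x) →
      ContinuousOn (uncurry fun t y => v t (y + t • c) - c) (Iio 0 ×ˢ univ) ∧
      (∃ K : ℝ, ∀ t < 0, ∀ x, ‖(fun t y => v t (y + t • c) - c) t x‖ ≤ K) ∧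
      (∀ t < 0, Literature.Analysis.FluidPDE.IsWeaklyDivFree ((fun t y => v t (y + t • c) - c) t)) ∧
      (∀ s t : ℝ, s < t → t < 0 → ∀ x,
        (fun t y => v t (y + t • c) - c) t x =
          Literature.Analysis.UnboundedOperators.heatExtension
              ((fun t y => v t (y + t • c) - c) s) (t - s) x -
            Literature.Analysis.FluidPDE.oseenDuhamel 1 s
              (fun t y => v t (y + t • c) - c) (fun t y => v t (y + t • c) - c) t x) := by
  intro v c hcont hbd hdiv hmild
  obtain ⟨K, hK⟩ := hbd
  have hK0 : 0 ≤ K := (norm_nonneg _).trans (hK (-1) (by norm_num) 0)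
  have hE : Module.finrank ℝ (EuclideanSpace ℝ (Fin 3)) = 3 := finrank_euclideanSpace_fin
  have hvc : ∀ σ : ℝ, σ < 0 → Continuous (v σ) := fun σ hσ =>
    hcont.comp_continuous (continuous_const.prodMk continuous_id) fun z =>
      mk_mem_prod (mem_Iio.2 hσ) (mem_univ z)
  set w : ℝ → EuclideanSpace ℝ (Fin 3) → EuclideanSpace ℝ (Fin 3) :=
    fun t y => v t (y + t • c) - c with hw
  refine ⟨?_, ⟨K + ‖c‖, fun t ht x => ?_⟩, fun t ht => ?_, fun s t hst ht0 y => ?_⟩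
  · -- joint continuity on the slab
    have h : ContinuousOn (fun q : ℝ × EuclideanSpace ℝ (Fin 3) =>
        uncurry v (q.1, q.2 + q.1 • c) - c) (Iio 0 ×ˢ univ) := by
      refine (hcont.comp (continuous_fst.prodMk
        (continuous_snd.add (continuous_fst.smul continuous_const))).continuousOn ?_).sub
        continuousOn_const
      intro q hq
      exact mk_mem_prod hq.1 (mem_univ _)
    exact h
  · -- the bound `K + ‖c‖`
    show ‖v t (x + t • c) - c‖ ≤ K + ‖c‖
    exact (norm_sub_le _ _).trans (add_le_add (hK t ht _) le_rfl)
  · -- weakly divergence-free slices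
    show IsWeaklyDivFree fun y => v t (y + t • c) - c
    have h1 : IsWeaklyDivFree fun y => v t (y + t • c) := (hdiv t ht).comp_add_right' (t • c)
    have h1c : Continuous fun y => v t (y + t • c) :=
      (hvc t ht).comp (continuous_id.add continuous_const)
    exact h1.sub_of_locallyIntegrable (isWeaklyDivFree_const c) h1c.locallyIntegrable
      continuous_const.locallyIntegrable
  · -- the Oseen identity of the boosted field
    -- window data: `a = s - 1 < s < t ≤ t' = t / 2 < 0`, clock `κ τ = min (τ + a) t'`
    set a : ℝ := s - 1 with ha
    set t' : ℝ := t / 2 with ht'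
    have ht'0 : t' < 0 := by rw [ht']; linarith
    have htt' : t ≤ t' := by rw [ht']; linarith
    set κ : ℝ → ℝ := fun τ => min (τ + a) t' with hκ
    have hκc : Continuous κ := (continuous_id.add continuous_const).min continuous_const
    have hκ0 : ∀ τ, κ τ < 0 := fun τ => (min_le_right _ _).trans_lt ht'0
    have hκw : ∀ τ ∈ Icc (0 : ℝ) (t' - a), κ τ = τ + a := fun τ hτ =>
      min_eq_left (by linarith [hτ.2])
    -- the translated field `v₁ = v(·, · + a • c)` and its window pair
    set v₁ : ℝ → EuclideanSpace ℝ (Fin 3) → EuclideanSpace ℝ (Fin 3) :=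
      fun σ z => v σ (z + a • c) with hv₁
    have hcont₁ : ContinuousOn (uncurry v₁) (Iio 0 ×ˢ univ) := by
      have h : ContinuousOn (fun q : ℝ × EuclideanSpace ℝ (Fin 3) => uncurry v (q.1, q.2 + a • c))
          (Iio 0 ×ˢ univ) := by
        refine hcont.comp
          (continuous_fst.prodMk (continuous_snd.add continuous_const)).continuousOn ?_
        intro q hq
        exact mk_mem_prod hq.1 (mem_univ _)
      exact h
    have hK₁ : ∀ t < 0, ∀ x, ‖v₁ t x‖ ≤ K := fun t ht x => hK t ht _
    have hdiv₁ : ∀ t < 0, IsWeaklyDivFree (v₁ t) := fun t ht =>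
      (hdiv t ht).comp_add_right' (a • c)
    have hmild₁ : ∀ s t : ℝ, s < t → t < 0 → ∀ x,
        v₁ t x = UnboundedOperators.heatExtension (v₁ s) (t - s) x -
          oseenDuhamel 1 s v₁ v₁ t x := by
      intro s' t' hs' ht' x
      rw [hv₁]
      dsimp only
      rw [heatExtension_comp_add_right_apply (v s') (a • c) (t' - s') x,
        oseenDuhamel_comp_add_right]
      exact hmild s' t' hs' ht' (x + a • c)
    have hUwin := driftMild_window hK0 hcont₁ hK₁ hdiv₁ hmild₁ c hκc hκ0 hκw
    have hV := IsKNSSDriftMild.galileanCovariance_R3 hUwin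
    have hsa : 0 < s - a := by rw [ha]; norm_num
    have hsata : s - a < t - a := by linarith
    have htaT : t - a < t' - a := by linarith
    have key := hV.eq_heatExtension_sub_oseenDuhamel hE hsa hsata htaT y
    -- the Galilean transform of the window pair is `w`, re-clocked
    have hG : ∀ ρ : ℝ, ρ + a ≤ t' →
        galileanShift (fun τ z => v₁ (κ τ) z - c) (fun _ => c) ρ = w (ρ + a) := by
      intro ρ hρ
      funext z
      have hP : driftPath (fun _ : ℝ => c) ρ = ρ • c := by
        rw [driftPath, intervalIntegral.integral_const, sub_zero]
      simp only [galileanShift_apply, hP, hw, hv₁, hκ, min_eq_left hρ, add_smul, add_assoc]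
    have hVt : galileanShift (fun τ z => v₁ (κ τ) z - c) (fun _ => c) (t - a) y = w t y := by
      rw [hG (t - a) (by linarith), sub_add_cancel]
    have hVs : galileanShift (fun τ z => v₁ (κ τ) z - c) (fun _ => c) (s - a) = w s := by
      rw [hG (s - a) (by linarith), sub_add_cancel]
    have hVτ : ∀ ρ ∈ Ioo (s - a) (t - a),
        galileanShift (fun τ z => v₁ (κ τ) z - c) (fun _ => c) ρ =ᵐ[volume]
          (fun ρ => w (ρ + a)) ρ :=
      fun ρ hρ => Filter.EventuallyEq.of_eq (hG ρ (by linarith [hρ.2]))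
    have hD : oseenDuhamel 1 (s - a) (galileanShift (fun τ z => v₁ (κ τ) z - c) (fun _ => c))
        (galileanShift (fun τ z => v₁ (κ τ) z - c) (fun _ => c)) (t - a) y =
        oseenDuhamel 1 s w w t y := by
      rw [oseenDuhamel_congr_ae_slice hVτ hVτ y, oseenDuhamel_translate, sub_add_cancel,
        sub_add_cancel]
    rw [hVt, hVs, hD, show t - a - (s - a) = t - s by ring] at key
    exact key

end Summit.NavierStokesRegularity.NavierStokesRegularity.Theorems

end
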